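import Literature.NumberTheory.EllipticCurves.FramedTateGaloisRep
import Literature.NumberTheory.EllipticCurves.TateModuleGaloisTransportProofs
import Literature.NumberTheory.EllipticCurves.TateModuleContinuityProofs
import Literature.NumberTheory.EllipticCurves.HasseWeilGoodReductionProofs
import Literature.NumberTheory.EllipticCurves.LocalH1TateDualityLangTateProofs
import Literature.NumberTheory.GaloisRepresentations.ArtinRestriction
import Literature.NumberTheory.GaloisRepresentations.FrobeniusPlaces
import Literature.NumberTheory.GaloisRepresentations.IntegralGaloisActionProofs
import HarnessLib

/-!
# The trace of Frobenius of an elliptic curve after base change: `a_w(E ⊗ L) = λ^f + μ^f`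

Topic `Literature/NumberTheory/EllipticCurves`; a *proofs* file (theorems only: no definition, no
named fact, no instance).  Written for the
discharge programme of `Literature.NumberTheory.Automorphic.isModularEllipticCurve_baseChange_rat_of_isSolvable`
(`Automorphic/SolvableBaseChangeModularity`: modularity of `E₀ ⊗ K` for `E₀ / ℚ` and `K` solvable
totally real), whose elliptic-curve input is the classical point-count identity over residue
field extensions (Weil; Silverman, *AEC*, Thm. V.2.3.1 and its proof: *"`#E(𝔽_{qⁿ}) =
qⁿ + 1 - αⁿ - βⁿ` where `α, β` are the roots of `T² - aT + q`"*), in the global form in which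
base-change arguments use it (Arthur–Clozel 1989, Ch. 3, (1.1): the Hecke–Frobenius class at a
place `w ∣ v` of the extension is the `f(w|v)`-th power of the class at `v`):

* `WeierstrassCurve.pow_add_pow_eq_eval_dickson` — Newton's power sums of the two roots of
  `X² - a X + d` are Mathlib's Dickson polynomials of the first kind:
  `λ + μ = a`, `λ μ = d ⟹ λ^f + μ^f = (Polynomial.dickson 1 d f).eval a`
  (`D₀ = 2`, `D₁ = X`, `D_{f+2} = X D_{f+1} - d D_f`);
* `WeierstrassCurve.charpoly_framedTateGaloisRep_apply`,
  `WeierstrassCurve.charpoly_rationalGaloisRepTate_absGaloisRestrict`,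
  `WeierstrassCurve.charpoly_framedTateGaloisRep_restrictField` — the characteristic polynomial of
  `γ ∈ Γ_L` on `V_ℓ(E)|_{Γ_L}` (restriction of the framed `ρ_{E,ℓ}` of `FramedTateGaloisRep`
  along `Γ_L → Γ_K`) is that of `γ` on `V_ℓ(E ⊗ L)` (the tree's
  `exists_rationalTateModule_equiv_baseChange`, `TateModuleGaloisTransportProofs`);
* `WeierstrassCurve.frobeniusTraceAt_baseChange_eq_eval_dickson` — **for an elliptic curve
  `E / K` over a number field with good reduction at `v`, a finite extension `L / K` and a place
  `w ∣ v` of `L`: `a_w(E ⊗ L) = D_{f(w|v)}(a_v(E); q_v) = λ^{f} + μ^{f}`**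
  (`WeierstrassCurve.frobeniusTraceAt` on both sides).

Proof of the last (Silverman, C.21 Remark 21.3 as proved in the tree, for a prime `ℓ` with
`v ∤ ℓ`): `ρ_{E,ℓ}` is unramified at `v` with arithmetic-Frobenius polynomial
`X² - a_v X + q_v = (X - λ)(X - μ)` over `ℚ̄_ℓ`
(`hasFrobCharpolyAt_rationalTateGaloisRepOf_of_hasGoodReductionAt` with
`trace/det_galoisRepTate_frobenius_of_hasGoodReductionAt_holds`); a Frobenius `φ_w ∈ Γ_L` maps
to `φ_v^{f}` modulo inertia (`FramedGaloisRep.exists_restrictField_apply_eq_pow`,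
`GaloisRepresentations/ArtinRestriction`), so has polynomial `(X - λ^f)(X - μ^f)` on
`V_ℓ(E)|_{Γ_L}` (`Matrix.charpoly_pow_eq_of_charpoly_eq_fin_two`) `= V_ℓ(E ⊗ L)`, where it is
also `X² - a_w(E ⊗ L) X + q_w` (`E ⊗ L` has good reduction at `w`,
`hasGoodReductionAt_baseChange_of_hasGoodReductionAt`); compare coefficients.

## References

* J. H. Silverman, *The Arithmetic of Elliptic Curves*, 2nd ed., GTM 106 (2009): Thm. V.2.3.1
  and its proof (point counts over `𝔽_{qⁿ}`), Remark V.2.6, C.21 Remark 21.3, Prop. VII.4.1(b),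
  Prop. VII.5.4(a). [SilvermanAEC2009]
* J.-P. Serre, *Abelian ℓ-adic representations and elliptic curves* (1968), Ch. I §1.2
  (`V_ℓ` of a base change), §2.1, §2.3. [SerreAbelianLadic1968]
* J. Arthur, L. Clozel, *Simple algebras, base change, and the advanced theory of the trace
  formula*, Ann. of Math. Stud. 120 (1989), Ch. 3, (1.1). [ArthurClozelAMS120]

## Design notes

The identity is stated over `ℤ` with Mathlib's `Polynomial.dickson 1 q_v f` evaluated at `a_v`,
so no roots need to be chosen and no definition is introduced.  Imports stay
inside `NumberTheory/EllipticCurves` and `NumberTheory/GaloisRepresentations`.  No `sorry`, no new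
instance; axioms `propext`, `Classical.choice`, `Quot.sound`.
-/

noncomputable section

open scoped NumberField MatrixGroups Matrix
open Field IsDedekindDomain Polynomial

universe u

namespace WeierstrassCurve

open Literature.NumberTheory.EllipticCurves Literature.NumberTheory.GaloisRepresentations

/-! ### Newton's power sums of two roots: Dickson polynomials -/

/-- **Newton's identity for two roots, via Mathlib's Dickson polynomials of the first kind**:
if `x + y = a` and `x y = d` then `x^f + y^f = D_f(a; d)` where `D_f = Polynomial.dickson 1 d f`
(`D₀ = 2`, `D₁ = X`, `D_{f+2} = X D_{f+1} - d D_f`).  For `a = a_v(E)`, `d = q_v` these are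
the traces of the powers of Frobenius.  Silverman, *AEC*, V.2.3.1 (proof,
`#E(𝔽_{qⁿ}) = qⁿ + 1 - αⁿ - βⁿ`); Lidl–Mullen–Turnwald, *Dickson polynomials* (1993), (1.1).
[folklore] -/
theorem pow_add_pow_eq_eval_dickson {R : Type*} [CommRing R] {x y a d : R} (hsum : x + y = a)
    (hprod : x * y = d) : ∀ f : ℕ, x ^ f + y ^ f = (Polynomial.dickson 1 d f).eval a
  | 0 => by norm_num [Polynomial.dickson_zero]
  | 1 => by simp [Polynomial.dickson_one, hsum]
  | (f + 2) => by
    rw [Polynomial.dickson_add_two, Polynomial.eval_sub, Polynomial.eval_mul,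
      Polynomial.eval_mul, Polynomial.eval_X, Polynomial.eval_C,
      ← pow_add_pow_eq_eval_dickson hsum hprod (f + 1),
      ← pow_add_pow_eq_eval_dickson hsum hprod f, ← hsum, ← hprod]
    ring

/-! ### Characteristic polynomials of `ρ_{E,ℓ}` and of its restriction to `Γ_L` -/

section Charpoly

variable {K : Type u} [Field K] [NumberField K] (W : WeierstrassCurve K) [W.IsElliptic]
  (ℓ : ℕ) [Fact ℓ.Prime]

/-- The characteristic polynomial of `ρ_{E,ℓ}(σ)` (the framed representation, with entries in
`ℚ̄_ℓ`) is the characteristic polynomial of `σ` on `V_ℓ E`, mapped along `ℚ_ℓ → ℚ̄_ℓ`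
(`Matrix.charpoly_map`, `LinearMap.charpoly_toMatrix`).  Silverman, *AEC*, III.§7 Remark 7.2.
[folklore] -/
theorem charpoly_framedTateGaloisRep_apply (σ : absoluteGaloisGroup K) :
    haveI := W.module_finite_rationalTateModule_holds ℓ
    FramedRep.charpoly (W.framedTateGaloisRep ℓ) σ =
      (W.rationalGaloisRepTate ℓ σ).charpoly.map (algebraMap ℚ_[ℓ] (PadicAlgCl ℓ)) := by
  haveI := W.module_finite_rationalTateModule_holds ℓ
  rw [FramedRep.charpoly, framedTateGaloisRep_def, coe_framedTateGaloisRepOfBasis_apply,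
    Matrix.charpoly_map, LinearMap.charpoly_toMatrix]
  rfl

variable (L : Type u) [Field L] [NumberField L] [Algebra K L]

/-- **`V_ℓ(E ⊗ L) ≅ V_ℓ(E)|_{Γ_L}` on characteristic polynomials**: for `γ ∈ Γ_L`, the
characteristic polynomial of `res γ` on `V_ℓ E` is that of `γ` on `V_ℓ(E ⊗ L)`
(`exists_rationalTateModule_equiv_baseChange`, `LinearEquiv.charpoly_conj`).
Serre (1968), Ch. I §1.2; Silverman, *AEC*, III.§7. [folklore] -/
theorem charpoly_rationalGaloisRepTate_absGaloisRestrict (γ : absoluteGaloisGroup L) :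
    haveI := W.module_finite_rationalTateModule_holds ℓ
    haveI := (W.baseChange L).module_finite_rationalTateModule_holds ℓ
    (W.rationalGaloisRepTate ℓ (absGaloisRestrict K L γ)).charpoly =
      ((W.baseChange L).rationalGaloisRepTate ℓ γ).charpoly := by
  haveI := W.module_finite_rationalTateModule_holds ℓ
  haveI := (W.baseChange L).module_finite_rationalTateModule_holds ℓ
  obtain ⟨E, hE⟩ := W.exists_rationalTateModule_equiv_baseChange L ℓ
  have he : E.conj (W.rationalGaloisRepTate ℓ (absGaloisRestrict K L γ)) =
      (W.baseChange L).rationalGaloisRepTate ℓ γ := by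
    refine LinearMap.ext fun y => ?_
    rw [LinearEquiv.conj_apply_apply, hE, LinearEquiv.apply_symm_apply]
  rw [← he, LinearEquiv.charpoly_conj]

/-- **The framed restriction and the framed base change have the same Frobenius polynomials**:
for every `γ ∈ Γ_L`, `charpoly (ρ_{E,ℓ}|_{Γ_L})(γ) = charpoly ρ_{E ⊗ L,ℓ}(γ)` (both are the
characteristic polynomial of `γ` on `V_ℓ(E ⊗ L) ≅ V_ℓ(E)|_{Γ_L}`).
Serre (1968), Ch. I §1.2 and §2.3. [folklore] -/
theorem charpoly_framedTateGaloisRep_restrictField (γ : absoluteGaloisGroup L) :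
    haveI : (W.baseChange L).IsElliptic := by rw [baseChange]; infer_instance
    FramedRep.charpoly ((W.framedTateGaloisRep ℓ).restrictField L) γ =
      FramedRep.charpoly ((W.baseChange L).framedTateGaloisRep ℓ) γ := by
  haveI : (W.baseChange L).IsElliptic := by rw [baseChange]; infer_instance
  have h1 : FramedRep.charpoly ((W.framedTateGaloisRep ℓ).restrictField L) γ =
      FramedRep.charpoly (W.framedTateGaloisRep ℓ) (absGaloisRestrict K L γ) := rfl
  rw [h1, W.charpoly_framedTateGaloisRep_apply, (W.baseChange L).charpoly_framedTateGaloisRep_apply,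
    W.charpoly_rationalGaloisRepTate_absGaloisRestrict]

end Charpoly

/-! ### `a_w(E ⊗ L) = D_{f(w|v)}(a_v(E); q_v) = λ^f + μ^f` -/

section Main

variable {K : Type u} [Field K] [NumberField K]

/-- A monic quadratic over an algebraically closed field factors as `(X - x)(X - y)` with
`x + y = a`, `x y = d`. [folklore] -/
theorem exists_eq_X_sub_C_mul_X_sub_C {R : Type*} [Field R] [IsAlgClosed R] (a d : R) :
    ∃ x y : R, x + y = a ∧ x * y = d ∧
      (X ^ 2 - C a * X + C d : R[X]) = (X - C x) * (X - C y) := by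
  have hdeg : (X ^ 2 - C a * X + C d : R[X]).degree ≠ 0 := by
    have h : (X ^ 2 - C a * X + C d : R[X]).degree = 2 := by
      compute_degree!
    rw [h]
    exact two_ne_zero
  obtain ⟨x, hx⟩ := IsAlgClosed.exists_root (X ^ 2 - C a * X + C d) hdeg
  have hx' : x ^ 2 - a * x + d = 0 := by
    simpa [Polynomial.IsRoot] using hx
  refine ⟨x, a - x, by ring, by linear_combination -hx', ?_⟩
  have e : d = x * (a - x) := by linear_combination hx'
  rw [e, map_mul, map_sub]
  ring

variable (W : WeierstrassCurve K) [W.IsElliptic] (L : Type u) [Field L] [NumberField L] [Algebra K L]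

/-- **The trace of Frobenius after base change.**  Let `E / K` be an elliptic curve over a
number field with good reduction at the finite place `v`, `L / K` a finite extension and `w` a
place of `L` above `v` of residue degree `f = f(w|v)`.  Then `E ⊗ L` has good reduction at `w`
and its trace of Frobenius there is the `f`-th Newton power sum of the Frobenius eigenvalues at
`v`: `a_w(E ⊗ L) = λ^f + μ^f = D_f(a_v(E); q_v)`, where `X² - a_v X + q_v = (X - λ)(X - μ)`
and `D_f` is the Dickson polynomial `Polynomial.dickson 1 q_v f` (`pow_add_pow_eq_eval_dickson`).  Proof (Silverman, *AEC*, V.2.3.1 and C.21 Remark 21.3, on the `ℓ`-adic side,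
`ℓ` a prime with `v ∤ ℓ`): every arithmetic Frobenius `φ_v` has characteristic polynomial
`X² - a_v X + q_v = (X - λ)(X - μ)` on `V_ℓ E` (`hasFrobCharpolyAt_rationalTateGaloisRepOf_of_hasGoodReductionAt`
with the tree's theorems `trace/det_galoisRepTate_frobenius_of_hasGoodReductionAt_holds`); a
Frobenius `φ_w ∈ Γ_L` restricts to `φ_v^f` modulo inertia, so has characteristic polynomial
`(X - λ^f)(X - μ^f)` on `V_ℓ(E)|_{Γ_L}` (`FramedGaloisRep.exists_restrictField_apply_eq_pow`,
`Matrix.charpoly_pow_eq_of_charpoly_eq_fin_two`); and `V_ℓ(E)|_{Γ_L} ≅ V_ℓ(E ⊗ L)`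
(`charpoly_framedTateGaloisRep_restrictField`), on which `φ_w` has characteristic polynomial
`X² - a_w(E ⊗ L) X + q_w` (good reduction of `E ⊗ L` at `w`,
`hasGoodReductionAt_baseChange_of_hasGoodReductionAt`).  Comparing the two, `a_w = λ^f + μ^f`.
[cite: SilvermanAEC2009, Thm. V.2.3.1 (with its proof: #E(𝔽_{qⁿ}) = qⁿ + 1 - αⁿ - βⁿ) and C.21 Remark 21.3] -/
theorem frobeniusTraceAt_baseChange_eq_eval_dickson {v : HeightOneSpectrum (𝓞 K)}
    {w : HeightOneSpectrum (𝓞 L)} (hw : w.asIdeal.under (𝓞 K) = v.asIdeal)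
    (hv : W.HasGoodReductionAt v) :
    (W.baseChange L).frobeniusTraceAt w =
      (Polynomial.dickson 1 (v.residueCard : ℤ) (w.asIdeal.inertiaDeg (𝓞 K))).eval
        (W.frobeniusTraceAt v) := by
  classical
  haveI hEL : (W.baseChange L).IsElliptic := by rw [baseChange]; infer_instance
  haveI : w.asIdeal.LiesOver v.asIdeal := ⟨hw.symm⟩
  -- a prime `ℓ` with `v ∤ ℓ` (hence `w ∤ ℓ`)
  obtain ⟨ℓ, hℓprime, hℓv⟩ : ∃ ℓ : ℕ, ℓ.Prime ∧ (ℓ : 𝓞 K) ∉ v.asIdeal := by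
    by_cases h2 : ((2 : ℕ) : 𝓞 K) ∈ v.asIdeal
    · refine ⟨3, Nat.prime_three, fun h3 ↦ v.isPrime.ne_top ?_⟩
      rw [Ideal.eq_top_iff_one]
      have h : ((3 : ℕ) : 𝓞 K) - ((2 : ℕ) : 𝓞 K) = 1 := by push_cast; norm_num
      rw [← h]
      exact sub_mem h3 h2
    · exact ⟨2, Nat.prime_two, h2⟩
  haveI : Fact ℓ.Prime := ⟨hℓprime⟩
  have hℓw : (ℓ : 𝓞 L) ∉ w.asIdeal := by
    intro h
    apply hℓv
    rw [← hw, Ideal.under_def, Ideal.mem_comap, map_natCast]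
    exact h
  -- good reduction of `E ⊗ L` at `w`
  have hw' : (W.baseChange L).HasGoodReductionAt w :=
    Literature.NumberTheory.EllipticCurves.hasGoodReductionAt_baseChange_of_hasGoodReductionAt W L v w hv
  set f := w.asIdeal.inertiaDeg (𝓞 K) with hf
  set ρ := W.framedTateGaloisRep ℓ with hρ
  -- the Frobenius polynomial of `ρ` at `v`
  have hur : ρ.IsUnramifiedAt v := W.isUnramifiedAt_framedTateGaloisRep ℓ hv hℓv
  haveI := W.module_finite_rationalTateModule_holds ℓ
  haveI := (W.baseChange L).module_finite_rationalTateModule_holds ℓ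
  have hPv : ρ.HasFrobCharpolyAt v
      ((X ^ 2 - C (W.frobeniusTraceAt v : ℚ_[ℓ]) * X +
        C (Nat.card (IsLocalRing.ResidueField (v.adicCompletionIntegers K)) : ℚ_[ℓ])).map
          (algebraMap ℚ_[ℓ] (PadicAlgCl ℓ))) :=
    (W.hasFrobCharpolyAt_framedTateGaloisRep_iff ℓ (W.continuous_rationalGaloisRepTate_holds ℓ)
        v _).2
      (W.hasFrobCharpolyAt_rationalTateGaloisRepOf_of_hasGoodReductionAt
        (W.trace_galoisRepTate_frobenius_of_hasGoodReductionAt_holds ℓ)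
        (W.det_galoisRepTate_frobenius_of_hasGoodReductionAt_holds ℓ) _ hℓv hv)
  -- the Frobenius polynomial of `ρ_{E ⊗ L}` at `w`
  have hPw : ((W.baseChange L).framedTateGaloisRep ℓ).HasFrobCharpolyAt w
      ((X ^ 2 - C ((W.baseChange L).frobeniusTraceAt w : ℚ_[ℓ]) * X +
        C (Nat.card (IsLocalRing.ResidueField (w.adicCompletionIntegers L)) : ℚ_[ℓ])).map
          (algebraMap ℚ_[ℓ] (PadicAlgCl ℓ))) :=
    ((W.baseChange L).hasFrobCharpolyAt_framedTateGaloisRep_iff ℓ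
        ((W.baseChange L).continuous_rationalGaloisRepTate_holds ℓ) w _).2
      ((W.baseChange L).hasFrobCharpolyAt_rationalTateGaloisRepOf_of_hasGoodReductionAt
        ((W.baseChange L).trace_galoisRepTate_frobenius_of_hasGoodReductionAt_holds ℓ)
        ((W.baseChange L).det_galoisRepTate_frobenius_of_hasGoodReductionAt_holds ℓ) _ hℓw hw')
  -- factor `X² - a_v X + q_v = (X - x)(X - y)` over `ℚ̄_ℓ`
  set a : PadicAlgCl ℓ := ((W.frobeniusTraceAt v : ℤ) : PadicAlgCl ℓ) with ha
  set q : PadicAlgCl ℓ := ((v.residueCard : ℕ) : PadicAlgCl ℓ) with hq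
  obtain ⟨x, y, hxy, hxy', hfac⟩ := exists_eq_X_sub_C_mul_X_sub_C a q
  have hPv' : ρ.HasFrobCharpolyAt v ((X - C x) * (X - C y)) := by
    have e : ((X ^ 2 - C (W.frobeniusTraceAt v : ℚ_[ℓ]) * X +
        C (Nat.card (IsLocalRing.ResidueField (v.adicCompletionIntegers K)) : ℚ_[ℓ])).map
          (algebraMap ℚ_[ℓ] (PadicAlgCl ℓ))) = X ^ 2 - C a * X + C q := by
      rw [natCard_residueField_eq_residueCard, Polynomial.map_add, Polynomial.map_sub,
        Polynomial.map_mul, Polynomial.map_pow, Polynomial.map_X, Polynomial.map_C,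
        Polynomial.map_C, map_intCast (algebraMap ℚ_[ℓ] (PadicAlgCl ℓ)),
        map_natCast (algebraMap ℚ_[ℓ] (PadicAlgCl ℓ))]
    rw [e, hfac] at hPv
    exact hPv
  -- Frobenius at `w` on the restriction `ρ|_{Γ_L}`: `(X - x^f)(X - y^f)`
  have key : ∀ 𝔔 ∈ w.primesAbove, ∀ τ : absoluteGaloisGroup L, IsArithFrobAt (𝓞 L) τ 𝔔 →
      FramedRep.charpoly (ρ.restrictField L) τ = (X - C (x ^ f)) * (X - C (y ^ f)) := by
    intro 𝔔 h𝔔 τ hτ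
    obtain ⟨𝔓, h𝔓, φ, hφ, heq⟩ := ρ.exists_restrictField_apply_eq_pow hw hur h𝔔 hτ
    have hch : FramedRep.charpoly ρ φ = (X - C x) * (X - C y) := hPv' 𝔓 h𝔓 φ hφ
    unfold FramedRep.charpoly at hch ⊢
    rw [heq, Units.val_pow_eq_pow_val]
    exact Matrix.charpoly_pow_eq_of_charpoly_eq_fin_two _ hch _
  -- compare the two Frobenius polynomials at an actual Frobenius `τ` at `w`
  obtain ⟨𝔔, h𝔔⟩ := w.primesAbove_nonempty
  obtain ⟨τ, hτ⟩ := HeightOneSpectrum.exists_isArithFrobAt_of_mem_primesAbove_holds h𝔔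
  have e1 := key 𝔔 h𝔔 τ hτ
  rw [hρ, W.charpoly_framedTateGaloisRep_restrictField ℓ L τ] at e1
  have e2 := hPw 𝔔 h𝔔 τ hτ
  rw [e1, natCard_residueField_eq_residueCard, Polynomial.map_add, Polynomial.map_sub,
    Polynomial.map_mul, Polynomial.map_pow, Polynomial.map_X, Polynomial.map_C, Polynomial.map_C,
    map_intCast (algebraMap ℚ_[ℓ] (PadicAlgCl ℓ)),
    map_natCast (algebraMap ℚ_[ℓ] (PadicAlgCl ℓ))] at e2
  -- `e2 : (X - x^f)(X - y^f) = X² - a_w X + q_w`; compare the coefficients of `X`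
  have emul : (X - C (x ^ f)) * (X - C (y ^ f)) =
      X ^ 2 - C (x ^ f + y ^ f) * X + C (x ^ f * y ^ f) := by
    rw [map_add, map_mul]; ring
  rw [emul] at e2
  have e3 := congrArg (fun P : (PadicAlgCl ℓ)[X] ↦ P.coeff 1) e2
  simp only [coeff_add, coeff_sub, coeff_C_mul, coeff_X_pow, coeff_X_one, coeff_C,
    if_neg (one_ne_zero), if_neg (show (1 : ℕ) ≠ 2 by decide)] at e3
  have e4 : (((W.baseChange L).frobeniusTraceAt w : ℤ) : PadicAlgCl ℓ) = x ^ f + y ^ f := by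
    linear_combination e3
  have e5 : (((Polynomial.dickson 1 (v.residueCard : ℤ) f).eval (W.frobeniusTraceAt v) : ℤ) :
      PadicAlgCl ℓ) = (Polynomial.dickson 1 q f).eval a := by
    have h5 := Polynomial.eval₂_hom (Int.castRingHom (PadicAlgCl ℓ)) (W.frobeniusTraceAt v)
      (p := Polynomial.dickson 1 (v.residueCard : ℤ) f)
    rw [← Polynomial.eval_map, Polynomial.map_dickson, eq_intCast, eq_intCast, eq_intCast,
      Int.cast_natCast] at h5
    rw [ha, hq]
    exact h5.symm
  apply Int.cast_injective (α := PadicAlgCl ℓ)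
  rw [e4, pow_add_pow_eq_eval_dickson hxy hxy' f, e5]

end Main

end WeierstrassCurve
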